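import Mathlib.Analysis.Convex.KreinMilman
import Mathlib.Topology.Semicontinuity.Basic

/-!
# Bauer's minimum principle (infrastructure for the law-level floor of line `palm-good-law`,
# crux `ReggeStarCoercivity.DefectFreeCrystallizes`, item stmt-AtomisticToContinuum-13603; lead c8, step E0)

The registered core `stub_funnelDefectFloor` of the line is an inequality `hcpE + κ·E_P[D] ≤ E_P[h]` that is AFFINE in the law `P`
and is to be proved over a convex, vaguely compact class of point-stationary laws.  Step E0 of the lead-c8 architecture reduces it to
the EXTREME (ergodic) laws of the class, along which every invariant statistic (mean metric, word frequencies) is constant.  The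
abstract tool is Bauer's principle: a lower semicontinuous concave (in particular affine) function on a non-empty compact subset of a
locally convex space attains its minimum at an extreme point — proved here from Mathlib's Krein–Milman lemma
(`IsCompact.extremePoints_nonempty`): the argmin set is a non-empty compact extreme subset, any of its extreme points is an extreme point
of the whole set (`IsExtreme.extremePoints_subset_extremePoints`).  Hence an affine lsc functional that is `≥ 0` on the extreme points is
`≥ 0` everywhere (`nonneg_of_nonneg_on_extremePoints`).  All `[folklore]` (H. Bauer 1958).
-/

open Set

namespace Summit.AtomisticToContinuum.Crystallization.Theorems.PalmGoodLaw.BauerMinimum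

variable {E : Type*} [AddCommGroup E] [Module ℝ E] [TopologicalSpace E] [T2Space E]
  [IsTopologicalAddGroup E] [ContinuousSMul ℝ E] [LocallyConvexSpace ℝ E]

/-- The argmin set of a function on `s` is a subset of `s`. [folklore] -/
theorem argmin_subset {α : Type*} {s : Set α} {f : α → ℝ} :
    {x ∈ s | ∀ y ∈ s, f x ≤ f y} ⊆ s := fun _ hx => hx.1

omit [TopologicalSpace E] [T2Space E] [IsTopologicalAddGroup E] [ContinuousSMul ℝ E] [LocallyConvexSpace ℝ E] in
/-- **The argmin set of a concave function is an extreme subset** (anchor of this file): for `f` concave on `s`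
(`ConcaveOn ℝ s f`) the set of minimisers of `f` on `s` is an extreme subset of `s`. [folklore] -/
theorem isExtreme_argmin {s : Set E} {f : E → ℝ} (hf : ConcaveOn ℝ s f) :
    IsExtreme ℝ s {x ∈ s | ∀ y ∈ s, f x ≤ f y} := by
  refine ⟨argmin_subset, ?_⟩
  intro x₁ hx₁ x₂ hx₂ x hx hseg
  obtain ⟨-, hxmin⟩ := hx
  obtain ⟨a, b, ha, hb, hab, rfl⟩ := hseg
  have hconc := hf.2 hx₁ hx₂ ha.le hb.le hab
  simp only [smul_eq_mul] at hconc
  have h1 := hxmin x₁ hx₁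
  have h2 := hxmin x₂ hx₂
  have hsum : a * f (a • x₁ + b • x₂) + b * f (a • x₁ + b • x₂) = f (a • x₁ + b • x₂) := by
    rw [← add_mul, hab, one_mul]
  -- concavity forces `f x₁ = min` (the structure only asks for the left endpoint)
  have e1 : f (a • x₁ + b • x₂) = f x₁ := by
    by_contra hne
    have hlt : f (a • x₁ + b • x₂) < f x₁ := lt_of_le_of_ne h1 hne
    have i1 := mul_lt_mul_of_pos_left hlt ha
    have i2 := mul_le_mul_of_nonneg_left h2 hb.le
    linarith
  exact Set.mem_sep hx₁ fun y hy => by rw [← e1]; exact hxmin y hy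

/-- **Bauer's minimum principle.**  A lower semicontinuous (on `s`) concave function on a non-empty compact set `s` of a locally convex
Hausdorff space attains its minimum over `s` at an extreme point of `s`. [folklore] -/
theorem exists_extremePoint_isMinOn {s : Set E} (hs : IsCompact s) (hne : s.Nonempty) {f : E → ℝ}
    (hlsc : LowerSemicontinuousOn f s) (hconc : ConcaveOn ℝ s f) :
    ∃ x ∈ s.extremePoints ℝ, ∀ y ∈ s, f x ≤ f y := by
  -- the minimum is attained on the compact set
  obtain ⟨x₀, hx₀s, hx₀⟩ := hlsc.exists_isMinOn hne hs
  set M : Set E := {x ∈ s | ∀ y ∈ s, f x ≤ f y} with hM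
  have hMne : M.Nonempty := ⟨x₀, hx₀s, fun y hy => hx₀ hy⟩
  -- `M = s ∩ {x | f x ≤ f x₀}` is closed in `s`, hence compact
  have hMeq : M = s ∩ f ⁻¹' Set.Iic (f x₀) := by
    ext x
    simp only [hM, mem_sep_iff, mem_inter_iff, mem_preimage, mem_Iic]
    constructor
    · rintro ⟨hxs, hx⟩; exact ⟨hxs, hx x₀ hx₀s⟩
    · rintro ⟨hxs, hx⟩; exact ⟨hxs, fun y hy => hx.trans (hx₀ hy)⟩
  have hMc : IsCompact M := by
    rw [hMeq]
    obtain ⟨v, hv, hvs⟩ := (lowerSemicontinuousOn_iff_preimage_Iic.1 hlsc) (f x₀)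
    rw [hvs]
    exact hs.inter_right hv
  obtain ⟨x, hx⟩ := hMc.extremePoints_nonempty hMne
  refine ⟨x, (isExtreme_argmin hconc).extremePoints_subset_extremePoints hx, ?_⟩
  exact (extremePoints_subset hx).2

/-- **Affine inequalities need only be checked on extreme points.**  If `f` is lower semicontinuous on the non-empty compact `s`,
concave on `s`, and `0 ≤ f` on the extreme points of `s`, then `0 ≤ f` on `s`. [folklore] -/
theorem nonneg_of_nonneg_on_extremePoints {s : Set E} (hs : IsCompact s) {f : E → ℝ}
    (hlsc : LowerSemicontinuousOn f s) (hconc : ConcaveOn ℝ s f)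
    (hext : ∀ x ∈ s.extremePoints ℝ, 0 ≤ f x) : ∀ y ∈ s, 0 ≤ f y := by
  intro y hy
  obtain ⟨x, hx, hmin⟩ := exists_extremePoint_isMinOn hs ⟨y, hy⟩ hlsc hconc
  exact (hext x hx).trans (hmin y hy)

/-- Monomorphic instance of `isExtreme_argmin` on the real line (the registered anchor of this helper file). [folklore] -/
theorem isExtreme_argmin_real : ∀ {s : Set ℝ} {f : ℝ → ℝ}, ConcaveOn ℝ s f → IsExtreme ℝ s {x ∈ s | ∀ y ∈ s, f x ≤ f y} :=
  fun hf => isExtreme_argmin hf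

end Summit.AtomisticToContinuum.Crystallization.Theorems.PalmGoodLaw.BauerMinimum
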